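import Summits.QuantumFields.GaugeBoot.BootstrapDiagonalReflectionPositivity
import Summits.QuantumFields.GaugeBoot.BootstrapRPCutDensity
import Summits.QuantumFields.GaugeBoot.DiagonalRPTorusNegativeAllTori
import HarnessLib

/-!
# The diagonal cut family on the torus: consistent with the bootstrap IFF the Wilson measure is
diagonally reflection positive — the full table (gauge-boot, L3 ↔ L1)

HONEST FRAMING (cell `pub-gaugeboot`, page 1 of every file): the venture produces certified bounds
on lattice expectations at stated coupling, gauge group, dimension and torus size; NOT a mass gap,
NOT a continuum limit, NOT a string tension; NOT Yang–Mills-summit-bearing (barriers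
`FixedCouplingUltralocality`, `PerturbativeInvisibility`). Structural; it certifies no number.
It says which positivity constraints a TORUS bootstrap may impose; nothing else.

## Content

`BootstrapDiagonalReflectionPositivity` settled the EVEN tori of dimension `≥ 3` (diagonal cuts
inconsistent at every `β`, by an explicit Polyakov-loop witness) and the even two-tori (gauge-invariant
diagonal cuts sound). Here the density theorem `rp_of_poly_rp` turns EVERY packaged torus statement
`DiagonalReflectionPositive ρ β i j` of the cell's task L3 — true or false — into a statement about
the PLAIN diagonal cut family (`0 ≤ φ ((v ∘ Θ_{ij}) · v)` for all level-`n` test functions `v` of the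
closed diagonal half, gauge invariant or not; `plainDiagRpLevelValuesSuN`):

* `configDiagSwap_eq_configPerm`, `measurePreserving_configDiagSwap_wilson` — the diagonal swap is
  the axis permutation `(i j)` and preserves the torus Wilson measure (every real `β`);
* `diagHalfLinks`, `isDiagonalHalfObservable_iff_dependsOn` — the closed-half support as a link set;
* ★★★ `diagonalReflectionPositive_iff_poly` — for every compact metrisable `G`, lattice representation
  `r`, real `β`: `DiagonalReflectionPositive r.ρ β i j ↔` (`0 ≤ ∫ p(Θ_{ij}U) p(U) dμ_Wilson` for every
  closed-half POLYNOMIAL `p`); `exists_poly_neg_of_not_diagonalReflectionPositive` — a failure always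
  has a polynomial witness;
* ★★★ `plainDiagCuts_sound_iff_suN` — `SU(N)` on `(ℤ/L)^d`, any `β`, any mirror: the plain diagonal
  cuts keep the Wilson value feasible at EVERY level for EVERY observable IFF
  `DiagonalReflectionPositive (fundamentalRep (Fin N)) β i j`; and when it fails the feasible sets are
  EMPTY at all large levels (`plainDiagRpLevelValues_eventually_eq_empty_suN`);
* the TABLE (instances of the cell's L3 theorems):
  ★★★ `plainDiagCuts_two_iff_suN` — `d = 2`, `L ≥ 4`, `N ≥ 2`: sound iff `(Odd L ∧ 0 ≤ β) ∨ β = 0`;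
  ★★ `plainDiagCuts_two_even_gauge_artefact_suN` — `d = 2`, even `L ≥ 4`, `β ≠ 0`: the PLAIN diagonal
  cuts empty the feasible sets eventually while the GAUGE-INVARIANT ones are sound at every level
  (the even-torus gauge artefact, bootstrap form);
  ★★★ `plainDiagCuts_eventually_infeasible_odd_suN` — every ODD torus `L ≥ 3` of dimension `d ≥ 3`,
  `N ≥ 2`: for all sufficiently small `β > 0` the diagonal cuts are inconsistent (with
  `diagRpLevelValues_eventually_eq_empty_suN` for even `L` at every `β`: NO torus of dimension `≥ 3`
  admits the third Kazakov–Zheng family as bootstrap cuts at small positive coupling).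

What this is NOT: the gauge-invariant family where only it is meaningful (`d ≥ 3` odd: covered by
the plain family's failure only where the witnesses are gauge invariant — not claimed); rates / the
level from which infeasibility sets in; `ℤ^d` (diagonal RP holds there).

References: V. Kazakov, Z. Zheng, arXiv:2203.11360 §3.1; K. Osterwalder, E. Seiler, Ann. Phys. 110
(1978) 440 §2; J. Fröhlich, R. Israel, E. H. Lieb, B. Simon, J. Stat. Phys. 22 (1980) 297 §3.
Folklore-level; not in print as theorems as far as the cell's searches go.
-/

noncomputable section

open MeasureTheory Filter Topology NormedSpace
open scoped ComplexOrder ComplexConjugate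
open Literature.MathematicalPhysics.QuantumFieldTheory (LatticeRep Site Edge GaugeConfig IsGaugeInvariant wilsonAction
  wilsonMeasure wilsonExpectation isProbabilityMeasure_wilsonMeasure)

namespace Summit.QuantumFields.GaugeBoot

/-! ## The diagonal swap preserves the Wilson measure; the closed half as a link set -/

section Wilson

variable {d L N : ℕ} {G : Type*} [Group G] [TopologicalSpace G] [IsTopologicalGroup G]
  [CompactSpace G] [MeasurableSpace G] [BorelSpace G] (ρ : G →* Matrix (Fin N) (Fin N) ℂ)

omit [Group G] [TopologicalSpace G] [IsTopologicalGroup G] [CompactSpace G] [BorelSpace G] in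
/-- The diagonal swap `Θ_{ij}` is the tree's axis permutation `(i j)` of torus configurations
(`Literature…configPerm`). -/
theorem configDiagSwap_eq_configPerm (i j : Fin d) :
    (configDiagSwap i j : GaugeConfig d L G → GaugeConfig d L G) =
      ⇑(Literature.MathematicalPhysics.QuantumFieldTheory.configPerm (Equiv.swap i j)) := by
  funext U e
  rw [Literature.MathematicalPhysics.QuantumFieldTheory.configPerm_apply, Equiv.symm_swap]
  simp only [configDiagSwap, edgeDiagSwap]
  rfl

variable [NeZero L]

/-- **The diagonal swap preserves the torus Wilson measure** (every real `β`, continuous `ρ`). -/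
theorem measurePreserving_configDiagSwap_wilson (hρ : Continuous ρ) (β : ℝ) (i j : Fin d) :
    MeasurePreserving (configDiagSwap i j) (wilsonMeasure (d := d) (L := L) ρ β) (wilsonMeasure ρ β) := by
  rw [configDiagSwap_eq_configPerm]
  exact ⟨(Literature.MathematicalPhysics.QuantumFieldTheory.configPerm _).measurable,
    Literature.MathematicalPhysics.QuantumFieldTheory.wilsonMeasure_map_configPerm ρ hρ β _⟩

omit [NeZero L] in
/-- **The links of the closed diagonal half** `{0 ≤ (y_i - y_j) mod L ≤ L/2}` (both endpoints in it).
[folklore] -/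
def diagHalfLinks (i j : Fin d) : Set (Edge d L) :=
  {e | (e.1 i - e.1 j).val ≤ L / 2 ∧ ((e.1.shift e.2) i - (e.1.shift e.2) j).val ≤ L / 2}

omit [NeZero L] [Group G] [TopologicalSpace G] [IsTopologicalGroup G] [CompactSpace G] [MeasurableSpace G]
  [BorelSpace G] in
/-- `IsDiagonalHalfObservable i j F` says exactly that `F` depends only on the links of
`diagHalfLinks i j`. -/
theorem isDiagonalHalfObservable_iff_dependsOn {α : Type*} (i j : Fin d) (F : GaugeConfig d L G → α) :
    IsDiagonalHalfObservable i j F ↔ DependsOn F (diagHalfLinks (L := L) i j) :=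
  ⟨fun h _ _ hUV => h _ _ fun e h1 h2 => hUV e ⟨h1, h2⟩, fun h _ _ hUV => h fun e he => hUV e he.1 he.2⟩

end Wilson

/-! ## Diagonal RP on the torus is decided by polynomial observables -/

section Poly

variable {d L : ℕ} [NeZero L] {G : Type*} [Group G] [TopologicalSpace G] [IsTopologicalGroup G]
  [CompactSpace G] [T2Space G] [SecondCountableTopology G] [MeasurableSpace G] [BorelSpace G]
  (r : LatticeRep G)

/-- ★★★ **Closed-half diagonal RP of the torus Wilson measure is decided by POLYNOMIAL observables.**
For every compact metrisable `G`, lattice representation `r`, real `β` and mirror `x_i = x_j`: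
`DiagonalReflectionPositive r.ρ β i j` (all bounded measurable complex closed-half observables) holds
iff `0 ≤ ∫ p(Θ_{ij}U) p(U) dμ_Wilson` for every closed-half polynomial observable `p` — the plain
diagonal cut family of a bootstrap. [folklore] -/
theorem diagonalReflectionPositive_iff_poly (β : ℝ) (i j : Fin d) :
    DiagonalReflectionPositive (d := d) (L := L) r.ρ β i j ↔
      ∀ p ∈ polyAlgebra (ι := Edge d L) r, IsDiagonalHalfObservable i j (⇑p) →
        0 ≤ ∫ U, p (configDiagSwap i j U) * p U ∂(wilsonMeasure (d := d) (L := L) r.ρ β) := by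
  refine ⟨fun h p _ hpH => wilson_diagRP_real r.ρ h p hpH, fun h F hF hFb hFH => ?_⟩
  haveI : IsProbabilityMeasure (wilsonMeasure (d := d) (L := L) r.ρ β) :=
    isProbabilityMeasure_wilsonMeasure (ρ := r.ρ) r.continuous β
  exact rp_of_poly_rp r (wilsonMeasure r.ρ β) (measurePreserving_configDiagSwap_wilson r.ρ r.continuous β i j)
    (configDiagSwap_configDiagSwap i j) (diagHalfLinks i j)
    (fun p hp hpS => h p hp ((isDiagonalHalfObservable_iff_dependsOn i j _).2 hpS)) hF hFb
    ((isDiagonalHalfObservable_iff_dependsOn i j F).1 hFH)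

/-- ★★ **A failure of diagonal RP always has a POLYNOMIAL witness**: if
`¬ DiagonalReflectionPositive r.ρ β i j` then some closed-half polynomial observable `p` has
`∫ p(Θ_{ij}U) p(U) dμ_Wilson < 0`. [folklore] -/
theorem exists_poly_neg_of_not_diagonalReflectionPositive {β : ℝ} {i j : Fin d}
    (h : ¬ DiagonalReflectionPositive (d := d) (L := L) r.ρ β i j) :
    ∃ p ∈ polyAlgebra (ι := Edge d L) r, IsDiagonalHalfObservable i j (⇑p) ∧
      ∫ U, p (configDiagSwap i j U) * p U ∂(wilsonMeasure (d := d) (L := L) r.ρ β) < 0 := by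
  rw [diagonalReflectionPositive_iff_poly] at h
  push Not at h
  obtain ⟨p, hp, hpH, hneg⟩ := h
  exact ⟨p, hp, hpH, hneg⟩

end Poly

/-! ## The plain diagonal cut family of the `SU(N)` bootstrap -/

section Unitary

open Literature.MathematicalPhysics.QuantumLattice

variable {d L : ℕ} [NeZero L] (N : ℕ) (β : ℝ)

/-- **The level-`n` feasible values of `P` with the PLAIN diagonal-RP cuts of the mirror `x_i = x_j`**:
`0 ≤ φ ((v ∘ Θ_{ij}) · v)` for every level-`n` test function `v` of the closed diagonal half, gauge
invariant or not (contrast `diagRpLevelValuesSuN`, gauge-invariant test functions only). [folklore] -/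
def plainDiagRpLevelValuesSuN (i j : Fin d) (n : ℕ)
    (P : C(GaugeConfig d L (Matrix.specialUnitaryGroup (Fin N) ℂ), ℝ)) : Set ℝ :=
  {t | ∃ φ : C(GaugeConfig d L (Matrix.specialUnitaryGroup (Fin N) ℂ), ℝ) →ₗ[ℝ] ℝ,
    IsBootstrapFeasible (fundamentalLatticeRep N) (suExp N)
        (fun _ => wilsonAction (fundamentalRep (Fin N))) β
        (wordTruncation (ι := Edge d L) (fundamentalLatticeRep N) n) φ ∧
      (∀ v ∈ wordTruncation (ι := Edge d L) (fundamentalLatticeRep N) n,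
        IsDiagonalHalfObservable i j (⇑v) → 0 ≤ φ (v.comp (diagSwapCM i j) * v)) ∧
      φ P = t}

/-- More cuts, fewer feasible functionals: plain-cut feasible values are gauge-invariant-cut feasible
values. -/
theorem plainDiagRpLevelValues_subset (i j : Fin d) (n : ℕ)
    (P : C(GaugeConfig d L (Matrix.specialUnitaryGroup (Fin N) ℂ), ℝ)) :
    plainDiagRpLevelValuesSuN (d := d) (L := L) N β i j n P ⊆ diagRpLevelValuesSuN (d := d) (L := L) N β i j n P := by
  rintro t ⟨φ, hφ, hcut, rfl⟩
  exact ⟨φ, hφ, fun v hv hvH _ => hcut v hv hvH, rfl⟩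

/-- **Soundness when the measure is diagonally RP**: the Wilson value satisfies the plain diagonal
cuts at every level. -/
theorem wilson_mem_plainDiagRpLevelValues_suN {i j : Fin d}
    (hRP : DiagonalReflectionPositive (d := d) (L := L) (fundamentalRep (Fin N)) β i j) (n : ℕ)
    (P : C(GaugeConfig d L (Matrix.specialUnitaryGroup (Fin N) ℂ), ℝ)) :
    ∫ U, P U ∂(wilsonMeasure (fundamentalRep (Fin N)) β) ∈
      plainDiagRpLevelValuesSuN (d := d) (L := L) N β i j n P := by
  haveI : IsProbabilityMeasure (wilsonMeasure (d := d) (L := L) (fundamentalRep (Fin N)) β) :=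
    isProbabilityMeasure_wilsonMeasure (ρ := fundamentalRep (Fin N)) (continuous_fundamentalRep _) β
  refine ⟨expectationFunctional (wilsonMeasure (fundamentalRep (Fin N)) β),
    isBootstrapFeasible_wilson_suN N β _ rfl (wordTruncation_subset_polyAlgebra _ n),
    fun v _ hvH => ?_, rfl⟩
  rw [expectationFunctional_apply]
  simpa only [ContinuousMap.mul_apply, ContinuousMap.comp_apply, diagSwapCM_apply] using
    wilson_diagRP_real (fundamentalRep (Fin N)) hRP v hvH

/-- ★★★ **Inconsistency when the measure is NOT diagonally RP**: if
`¬ DiagonalReflectionPositive (fundamentalRep (Fin N)) β i j`, then for every observable `P` the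
plain-cut feasible values are EMPTY at all large levels. [folklore] -/
theorem plainDiagRpLevelValues_eventually_eq_empty_suN {i j : Fin d}
    (hRP : ¬ DiagonalReflectionPositive (d := d) (L := L) (fundamentalRep (Fin N)) β i j)
    (P : C(GaugeConfig d L (Matrix.specialUnitaryGroup (Fin N) ℂ), ℝ)) :
    ∀ᶠ n in atTop, plainDiagRpLevelValuesSuN (d := d) (L := L) N β i j n P = ∅ := by
  have hRP' : ¬ DiagonalReflectionPositive (d := d) (L := L) (fundamentalLatticeRep N).ρ β i j := hRP
  obtain ⟨f, hf, hfH, hneg⟩ := exists_poly_neg_of_not_diagonalReflectionPositive (fundamentalLatticeRep N) hRP'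
  have hneg' : ∫ U, f (configDiagSwap i j U) * f U ∂(wilsonMeasure (fundamentalRep (Fin N)) β) < 0 := hneg
  have hQ : f.comp (diagSwapCM i j) * f ∈ polyAlgebra (ι := Edge d L) (fundamentalLatticeRep N) :=
    Subalgebra.mul_mem _ (comp_diagSwapCM_mem_polyAlgebra _ i j hf) hf
  have hW : ∫ U, (f.comp (diagSwapCM i j) * f) U ∂(wilsonMeasure (fundamentalRep (Fin N)) β) < 0 := by
    simpa only [ContinuousMap.mul_apply, ContinuousMap.comp_apply, diagSwapCM_apply] using hneg'
  filter_upwards [eventually_mem_wordTruncation (fundamentalLatticeRep N) hf,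
    bootstrap_convergence_words_suN (d := d) (L := L) N β hQ
      (ε := -(∫ U, (f.comp (diagSwapCM i j) * f) U ∂(wilsonMeasure (fundamentalRep (Fin N)) β)) / 2)
      (by linarith)] with n hfn hconv
  refine Set.eq_empty_iff_forall_notMem.2 fun t ⟨φ, hφ, hcut, _⟩ => ?_
  have h0 := hcut f hfn hfH
  have h2 := (abs_le.1 (hconv φ hφ)).2
  linarith

/-- ★★★ **The plain diagonal cuts are consistent with the `SU(N)` torus bootstrap IFF the Wilson
measure is diagonally reflection positive**: `DiagonalReflectionPositive (fundamentalRep (Fin N)) β i j`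
holds iff the Wilson value of every observable is feasible with the cuts at every level.
[folklore] -/
theorem plainDiagCuts_sound_iff_suN (i j : Fin d) :
    DiagonalReflectionPositive (d := d) (L := L) (fundamentalRep (Fin N)) β i j ↔
      ∀ (n : ℕ) (P : C(GaugeConfig d L (Matrix.specialUnitaryGroup (Fin N) ℂ), ℝ)),
        ∫ U, P U ∂(wilsonMeasure (fundamentalRep (Fin N)) β) ∈
          plainDiagRpLevelValuesSuN (d := d) (L := L) N β i j n P := by
  refine ⟨fun h n P => wilson_mem_plainDiagRpLevelValues_suN N β h n P, fun h => ?_⟩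
  by_contra hRP
  obtain ⟨n, hn⟩ := (plainDiagRpLevelValues_eventually_eq_empty_suN N β hRP 1).exists
  have hmem := h n 1
  rw [hn] at hmem
  exact hmem

/-! ## The table -/

/-- ★★★ **Two dimensions** (`(ℤ/L)²`, `L ≥ 4`, `SU(N)` with `N ≥ 2`, `i ≠ j`, any real `β`): the plain
diagonal cuts are consistent with the bootstrap iff `(L` is odd and `0 ≤ β)` or `β = 0`
(`DiagRPTwo.diagonalReflectionPositive_two_iff_suN`). [folklore] -/
theorem plainDiagCuts_two_iff_suN (h4 : 4 ≤ L) (hN : 2 ≤ N) {i j : Fin 2} (hij : i ≠ j) :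
    (∀ (n : ℕ) (P : C(GaugeConfig 2 L (Matrix.specialUnitaryGroup (Fin N) ℂ), ℝ)),
        ∫ U, P U ∂(wilsonMeasure (fundamentalRep (Fin N)) β) ∈
          plainDiagRpLevelValuesSuN (d := 2) (L := L) N β i j n P) ↔ (Odd L ∧ 0 ≤ β) ∨ β = 0 := by
  rw [← plainDiagCuts_sound_iff_suN N β i j]
  exact DiagRPTwo.diagonalReflectionPositive_two_iff_suN hN (by omega) β hij

/-- ★★ **The even-torus gauge artefact, bootstrap form** (`(ℤ/L)²`, `L ≥ 4` even, `N ≥ 2`, `β ≠ 0`):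
the PLAIN diagonal cuts empty the feasible sets at all large levels, while the GAUGE-INVARIANT
diagonal cuts keep the Wilson value feasible at every level. [folklore] -/
theorem plainDiagCuts_two_even_gauge_artefact_suN (hL : Even L) (h4 : 4 ≤ L) (hN : 2 ≤ N)
    {i j : Fin 2} (hij : i ≠ j) (hβ : β ≠ 0)
    (P : C(GaugeConfig 2 L (Matrix.specialUnitaryGroup (Fin N) ℂ), ℝ)) :
    (∀ᶠ n in atTop, plainDiagRpLevelValuesSuN (d := 2) (L := L) N β i j n P = ∅) ∧
      ∀ n, ∫ U, P U ∂(wilsonMeasure (fundamentalRep (Fin N)) β) ∈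
        diagRpLevelValuesSuN (d := 2) (L := L) N β i j n P :=
  ⟨plainDiagRpLevelValues_eventually_eq_empty_suN N β
      (DiagRPTwo.even_torus_gauge_artefact_suN hL h4 hN hij hβ).1 P,
    fun n => wilson_mem_diagRpLevelValues_two_suN N β hL h4 hij n P⟩

/-- ★★★ **Odd tori of dimension `≥ 3`** (`(ℤ/L)^d`, `d ≥ 3`, `L ≥ 3` odd, `SU(N)` with `N ≥ 2`,
mirror `x₀ = x₁`): there is `β₀ > 0` such that for all `0 < β ≤ β₀` and every observable `P` the
plain diagonal cuts empty the feasible sets at all large levels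
(`DiagRPRest.diagonalRP_fails_suN`). With `diagRpLevelValues_eventually_eq_empty_suN` (even `L`,
every `β`): no torus of dimension `≥ 3` admits the diagonal cut family at small positive coupling.
[folklore] -/
theorem plainDiagCuts_eventually_infeasible_odd_suN (hd : 3 ≤ d) (hL3 : 3 ≤ L) (hLo : Odd L)
    (hN : 2 ≤ N) :
    ∃ β₀ : ℝ, 0 < β₀ ∧ ∀ β : ℝ, 0 < β → β ≤ β₀ →
      ∀ P : C(GaugeConfig d L (Matrix.specialUnitaryGroup (Fin N) ℂ), ℝ),
        ∀ᶠ n in atTop, plainDiagRpLevelValuesSuN (d := d) (L := L) N β ⟨0, by omega⟩ ⟨1, by omega⟩ n P = ∅ := by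
  obtain ⟨β₀, hβ₀, h⟩ := DiagRPRest.diagonalRP_fails_suN (d := d) (L := L) (N := N) hd hL3 hN
  exact ⟨β₀, hβ₀, fun β hβ hβ1 P =>
    plainDiagRpLevelValues_eventually_eq_empty_suN N β ((h β hβ hβ1).1 hLo) P⟩

end Unitary

end Summit.QuantumFields.GaugeBoot

end
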